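import Summits.KontsevichZagierPeriods.KontsevichZagierPeriods.Theorems.LinRedNormalFormArrangementNormalFormSeparateThreeHHKChart
import Summits.KontsevichZagierPeriods.KontsevichZagierPeriods.Theorems.LinRedNormalFormArrangementNormalFormSeparateTwoHICover

/-!
# Covering a cone of directions by finitely many nested thin sectors

(Line `janus-bands`, crux `ArrangementNormalForm`, stub `stub_separateHigh`, part `HHKCover` of
the wall-invariant termwise-split lemma `separateThree_hHk` in base dimension `3` with fibres.)
The first globalisation step of the local analysis at a base point `z₁ ∈ ℝ³`: for a direction
`d` and a frame plane spanned by `A, B` (`emb A B w = w₀ A + w₁ B`), the CONE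
`{z₁ + t (d + emb A B w) | t ∈ (0, δt), |w₀|, |w₁| < δ'}` over a planar neighbourhood of `d` in
`d + span (A, B)` is covered by the open ray `z₁ + t d` and the nested thin sectors (part
`HHKChart`) over the planar thin sectors of part `HICover`: the four VERTICAL ones (frame
`p B, q A`) and, for finitely many slopes `a`, the four of SLOPE `a` (frame
`o ρ (A + a B), σ B`). `planar_cover` is the set-theoretic content of `SepTwo.cover_nhds`
(compactness of the slope interval); `cone_finite` (registered as `separateThreeHHK_cover`)
concludes: a measure vanishing on the line `z₁ + ℝ d`, finite on the vertical nested sectors at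
one scale and, for EVERY slope `r`, on the nested sectors of slope `r` at some scale (including
the `t`-scale), is finite on such a cone.
-/

noncomputable section

open Set MeasureTheory Filter Topology
open scoped ENNReal

namespace Summit.KontsevichZagierPeriods.ArrangementNormalForm.JanusBands

namespace SepHHK

open SepTwo

/-! ### The planar covering, set-theoretically -/

/-- **The planar covering lemma (sets).** Given the vertical scale `(δV, εV)` and, for every
slope `r`, scales `ρ r, δ r, ε r > 0`, there are finitely many slopes `T` and `δ' > 0` such that
every non-zero `w` with `|w₀|, |w₁| < δ'` lies in one of the four vertical planar sectors or in
one of the four planar sectors of some slope `a ∈ T`. -/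
theorem planar_cover {δV εV : ℝ} (hδV : 0 < δV) (hεV : 0 < εV) (ρ δ ε : ℝ → ℝ)
    (hρ : ∀ r, 0 < ρ r) (hδ : ∀ r, 0 < δ r) (hε : ∀ r, 0 < ε r) :
    ∃ (T : Finset ℝ) (δ' : ℝ), 0 < δ' ∧ ∀ w : Fin 2 → ℝ, w ≠ 0 → |w 0| < δ' → |w 1| < δ' →
      (∃ p q : ℝ, |p| = 1 ∧ |q| = 1 ∧ w ∈ sector 0 ![0, p] ![q, q * 0] δV (Ico 0 εV)) ∨
      (∃ a ∈ T, ∃ o σ : ℝ, |o| = 1 ∧ |σ| = 1 ∧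
        w ∈ sector 0 ![o * ρ a, o * ρ a * (0 + a)] ![0, σ] (δ a) (Ico 0 (ε a))) := by
  classical
  set K : ℝ := εV⁻¹ with hK
  have hK0 : 0 < K := inv_pos.2 hεV
  have hcov : Icc (-K) K ⊆ ⋃ r : ℝ, Ioo (r - ε r / ρ r) (r + ε r / ρ r) := fun r _ =>
    mem_iUnion.2 ⟨r, by constructor <;> linarith [div_pos (hε r) (hρ r)]⟩
  obtain ⟨T, hT⟩ := isCompact_Icc.elim_finite_subcover (fun r : ℝ => Ioo (r - ε r / ρ r)
    (r + ε r / ρ r)) (fun _ => isOpen_Ioo) hcov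
  obtain ⟨δH, hδH, hδHa⟩ := exists_pos_le_finset T (fun a => ρ a * δ a)
    fun a _ => mul_pos (hρ a) (hδ a)
  set δ' := min δV δH with hδ'
  have hδ'0 : 0 < δ' := lt_min hδV hδH
  have hpm1 : ∀ x : ℝ, x ∈ ({1, -1} : Finset ℝ) → |x| = 1 := fun x hx => by
    rcases Finset.mem_insert.1 hx with rfl | hx
    · exact abs_one
    · rw [Finset.mem_singleton.1 hx]; simp
  refine ⟨T, δ', hδ'0, fun w hw0 hw0' hw1' => ?_⟩
  have e0 : ∀ i, (0 : Fin 2 → ℝ) i = 0 := fun i => rfl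
  have hμ' : w 1 - (0 : Fin 2 → ℝ) 1 - 0 * (w 0 - (0 : Fin 2 → ℝ) 0) = w 1 := by rw [e0, e0]; ring
  have hξ' : w 0 - (0 : Fin 2 → ℝ) 0 = w 0 := by rw [e0]; ring
  have hVmem : w 1 ≠ 0 → |w 0| < εV * |w 1| →
      ∃ p q : ℝ, |p| = 1 ∧ |q| = 1 ∧ w ∈ sector 0 ![0, p] ![q, q * 0] δV (Ico 0 εV) := by
    intro hμ0 hlt
    obtain ⟨p, hp, hpμ⟩ := exists_pm_mul_abs (w 1)
    obtain ⟨q, hq, hqξ⟩ := exists_pm_mul_abs (w 0)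
    refine ⟨p, q, hpm1 p hp, hpm1 q hq, mem_vsector 0 w 0 δV εV p q ?_ ?_ ?_ ?_ ?_⟩
    · rw [hμ']; exact hpμ
    · rw [hξ']; exact hqξ
    · rw [hμ']; exact hμ0
    · rw [hμ']; exact hw1'.trans_le (min_le_left _ _)
    · rw [hμ', hξ']; exact hlt
  by_cases hξ0 : w 0 = 0
  · have hμ0 : w 1 ≠ 0 := by
      intro hμ0
      refine hw0 (funext fun i => ?_)
      fin_cases i
      · exact hξ0
      · exact hμ0
    refine Or.inl (hVmem hμ0 ?_)
    rw [hξ0, abs_zero]; exact mul_pos hεV (abs_pos.2 hμ0)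
  by_cases hKμ : K * |w 0| < |w 1|
  · have hμ0 : w 1 ≠ 0 := by
      intro h; rw [h, abs_zero] at hKμ
      exact absurd hKμ (not_lt.2 (by positivity))
    refine Or.inl (hVmem hμ0 ?_)
    calc |w 0| = εV * (K * |w 0|) := by rw [hK]; field_simp
      _ < εV * |w 1| := mul_lt_mul_of_pos_left hKμ hεV
  · push Not at hKμ
    have hξp : 0 < |w 0| := abs_pos.2 hξ0
    have hrS : w 1 / w 0 ∈ Icc (-K) K := by
      rw [mem_Icc, ← abs_le, abs_div, div_le_iff₀ hξp]; exact hKμ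
    obtain ⟨a, ha⟩ := mem_iUnion.1 (hT hrS)
    obtain ⟨haT, har⟩ := mem_iUnion.1 ha
    have har' : |w 1 / w 0 - a| < ε a / ρ a := by
      rw [abs_lt]; constructor <;> linarith [har.1, har.2]
    refine Or.inr ⟨a, haT, ?_⟩
    obtain ⟨o, ho, hoξ⟩ := exists_pm_mul_abs (w 0)
    obtain ⟨σ, hσ, hσμ⟩ := exists_pm_mul_abs (w 1 / w 0 - a)
    refine ⟨o, o * σ, hpm1 o ho, by rw [abs_mul, hpm1 o ho, hpm1 σ hσ, one_mul], ?_⟩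
    refine mem_hsector 0 w 0 a (δ a) (ε a) o σ (hρ a) ?_ ?_ ?_ ?_ ?_
    · rw [hξ']; exact hoξ
    · rw [hμ', hξ']; exact hσμ
    · rw [hξ']; exact hξ0
    · rw [hξ']; exact hw0'.trans_le ((min_le_right _ _).trans (hδHa a haT))
    · rw [hμ', hξ']; exact har'

/-! ### From planar sectors to nested sectors -/

/-- The frame-plane embedding `w ↦ w₀ A + w₁ B`. -/
def emb (A B : Fin 3 → ℝ) (w : Fin 2 → ℝ) : Fin 3 → ℝ := w 0 • A + w 1 • B

/-- The embedding on a vector literal. -/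
theorem emb_vec (A B : Fin 3 → ℝ) (a b : ℝ) : emb A B ![a, b] = a • A + b • B := by
  simp [emb]

/-- **A planar thin sector lifts to a nested thin sector.** -/
theorem mem_nsector_of_mem_sector (z₁ d A B : Fin 3 → ℝ) {P Q : Fin 2 → ℝ} {δ : ℝ} {J : Set ℝ}
    {w : Fin 2 → ℝ} (hw : w ∈ sector 0 P Q δ J) {δt t : ℝ} (ht : t ∈ Ioo 0 δt) :
    z₁ + t • (d + emb A B w) ∈ nsector z₁ d (emb A B P) (emb A B Q) δt δ J := by
  obtain ⟨s, hs, u, hu, rfl⟩ := (mem_sector_iff 0 P Q δ J w).1 hw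
  have h : z₁ + t • (d + emb A B (bpt 0 P Q s u)) = npt z₁ d (emb A B P) (emb A B Q) t s u := by
    funext k
    simp only [npt, emb, bpt, Pi.add_apply, Pi.smul_apply, smul_eq_mul, Pi.zero_apply, zero_add]
    ring
  rw [h]
  exact npt_mem_nsector ht hs hu

/-- The lifted vertical frame. -/
theorem emb_vframe (A B : Fin 3 → ℝ) (p q : ℝ) :
    emb A B ![0, p] = p • B ∧ emb A B ![q, q * 0] = q • A := by
  constructor <;> simp [emb]

/-- The lifted frame of slope `a`. -/
theorem emb_hframe (A B : Fin 3 → ℝ) (o ρ a σ : ℝ) :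
    emb A B ![o * ρ, o * ρ * (0 + a)] = (o * ρ) • (A + a • B) ∧ emb A B ![0, σ] = σ • B := by
  constructor
  · simp only [emb, Matrix.cons_val_zero, Matrix.cons_val_one, zero_add, smul_add, smul_smul]
  · simp [emb]

/-! ### The cone over a planar neighbourhood -/

/-- The cone `{z₁ + t (d + emb A B w) | t ∈ (0, δt), |w₀| < δ', |w₁| < δ'}`. -/
def dcone (z₁ d A B : Fin 3 → ℝ) (δt δ' : ℝ) : Set (Fin 3 → ℝ) :=
  {z | ∃ t ∈ Ioo (0 : ℝ) δt, ∃ w : Fin 2 → ℝ, |w 0| < δ' ∧ |w 1| < δ' ∧ z = z₁ + t • (d + emb A B w)}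

/-- The line `z₁ + ℝ d`. -/
def dline (z₁ d : Fin 3 → ℝ) : Set (Fin 3 → ℝ) := {z | ∃ t : ℝ, z = z₁ + t • d}

/-- **Finiteness on a cone of directions.** See the module docstring. -/
theorem cone_finite (ν : Measure (Fin 3 → ℝ)) (z₁ d A B : Fin 3 → ℝ) (hline : ν (dline z₁ d) = 0)
    {δtV δV εV : ℝ} (hδtV : 0 < δtV) (hδV : 0 < δV) (hεV : 0 < εV)
    (hV : ∀ p q : ℝ, |p| = 1 → |q| = 1 →
      ν (nsector z₁ d (p • B) (q • A) δtV δV (Ico 0 εV)) < ∞)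
    (hH : ∀ r : ℝ, ∃ δt > 0, ∃ ρ > 0, ∃ δ > 0, ∃ ε > 0, ∀ o σ : ℝ, |o| = 1 → |σ| = 1 →
      ν (nsector z₁ d ((o * ρ) • (A + r • B)) (σ • B) δt δ (Ico 0 ε)) < ∞) :
    ∃ δ' > 0, ∃ δt > 0, ν (dcone z₁ d A B δt δ') < ∞ := by
  classical
  choose δtr hδtr ρ hρ δ hδ ε hε hfin using hH
  obtain ⟨T, δ', hδ'0, hcov⟩ := planar_cover hδV hεV ρ δ ε hρ hδ hε
  obtain ⟨δtH, hδtH, hδtHa⟩ := exists_pos_le_finset T δtr fun a _ => hδtr a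
  set δt := min δtV δtH with hδt
  have hδt0 : 0 < δt := lt_min hδtV hδtH
  set pm : Finset ℝ := {1, -1} with hpm
  have hpm1 : ∀ x ∈ pm, |x| = 1 := fun x hx => by
    rcases Finset.mem_insert.1 hx with rfl | hx
    · exact abs_one
    · rw [Finset.mem_singleton.1 hx]; simp
  set SV : Set (Fin 3 → ℝ) := ⋃ p ∈ pm, ⋃ q ∈ pm, nsector z₁ d (p • B) (q • A) δtV δV (Ico 0 εV)
    with hSV
  set SH : Set (Fin 3 → ℝ) := ⋃ a ∈ T, ⋃ o ∈ pm, ⋃ σ ∈ pm,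
    nsector z₁ d ((o * ρ a) • (A + a • B)) (σ • B) (δtr a) (δ a) (Ico 0 (ε a)) with hSH
  have hSVfin : ν SV < ∞ := by
    refine measure_biUnion_lt_top pm.finite_toSet fun p hp => ?_
    refine measure_biUnion_lt_top pm.finite_toSet fun q hq => ?_
    exact hV p q (hpm1 p hp) (hpm1 q hq)
  have hSHfin : ν SH < ∞ := by
    refine measure_biUnion_lt_top T.finite_toSet fun a _ => ?_
    refine measure_biUnion_lt_top pm.finite_toSet fun o ho => ?_
    refine measure_biUnion_lt_top pm.finite_toSet fun σ hσ => ?_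
    exact hfin a o σ (hpm1 o ho) (hpm1 σ hσ)
  refine ⟨δ', hδ'0, δt, hδt0, ?_⟩
  have hsub : dcone z₁ d A B δt δ' ⊆ dline z₁ d ∪ SV ∪ SH := by
    rintro z ⟨t, ht, w, hw0, hw1, rfl⟩
    by_cases hw : w = 0
    · refine Or.inl (Or.inl ⟨t, ?_⟩)
      rw [hw]; simp [emb]
    rcases hcov w hw hw0 hw1 with ⟨p, q, hp, hq, hmem⟩ | ⟨a, haT, o, σ, ho, hσ, hmem⟩
    · refine Or.inl (Or.inr ?_)
      rw [hSV]
      refine mem_iUnion₂.2 ⟨p, mem_pm_of_abs hp, mem_iUnion₂.2 ⟨q, mem_pm_of_abs hq, ?_⟩⟩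
      have h := mem_nsector_of_mem_sector z₁ d A B hmem (δt := δtV)
        ⟨ht.1, ht.2.trans_le (min_le_left _ _)⟩
      rwa [(emb_vframe A B p q).1, (emb_vframe A B p q).2] at h
    · refine Or.inr ?_
      rw [hSH]
      refine mem_iUnion₂.2 ⟨a, haT, mem_iUnion₂.2 ⟨o, mem_pm_of_abs ho,
        mem_iUnion₂.2 ⟨σ, mem_pm_of_abs hσ, ?_⟩⟩⟩
      have h := mem_nsector_of_mem_sector z₁ d A B hmem (δt := δtr a)
        ⟨ht.1, ht.2.trans_le ((min_le_right _ _).trans (hδtHa a haT))⟩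
      rwa [(emb_hframe A B o (ρ a) a σ).1, (emb_hframe A B o (ρ a) a σ).2] at h
  calc ν (dcone z₁ d A B δt δ') ≤ ν (dline z₁ d ∪ SV ∪ SH) := measure_mono hsub
    _ < ∞ := measure_union_lt_top (measure_union_lt_top (hline.trans_lt ENNReal.zero_lt_top)
        hSVfin) hSHfin

end SepHHK

/-- **Finiteness of a measure on a cone of directions covered by nested thin sectors**
(registered part of `stub_separateHigh`, base dimension `3` with fibres; literal form of
`SepHHK.cone_finite`): a measure on `ℝ³` vanishing on the line `z₁ + ℝ d`, finite on the four
vertical nested sectors over the frame plane `span (A, B)` at one scale and, for every slope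
`r`, on the four nested sectors of slope `r` at some scale, is finite on the cone
`{z₁ + t (d + w₀ A + w₁ B) | t ∈ (0, δt), |w₀|, |w₁| < δ'}` for some `δ', δt > 0`. -/
theorem separateThreeHHK_cover (ν : MeasureTheory.Measure (Fin 3 → ℝ)) (z₁ d A B : Fin 3 → ℝ) (hline : ν {z | ∃ t : ℝ, z = z₁ + t • d} = 0) (δtV δV εV : ℝ) (hδtV : 0 < δtV) (hδV : 0 < δV) (hεV : 0 < εV) (hV : ∀ p q : ℝ, |p| = 1 → |q| = 1 → ν (SepHHK.nsector z₁ d (p • B) (q • A) δtV δV (Set.Ico 0 εV)) < ⊤) (hH : ∀ r : ℝ, ∃ δt > 0, ∃ ρ > 0, ∃ δ > 0, ∃ ε > 0, ∀ o σ : ℝ, |o| = 1 → |σ| = 1 → ν (SepHHK.nsector z₁ d ((o * ρ) • (A + r • B)) (σ • B) δt δ (Set.Ico 0 ε)) < ⊤) : ∃ δ' > 0, ∃ δt > 0, ν {z | ∃ t ∈ Set.Ioo (0 : ℝ) δt, ∃ w : Fin 2 → ℝ, |w 0| < δ' ∧ |w 1| < δ' ∧ z = z₁ + t • (d + (w 0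 • A + w 1 • B))} < ⊤ := by
  exact SepHHK.cone_finite ν z₁ d A B hline hδtV hδV hεV hV hH

end Summit.KontsevichZagierPeriods.ArrangementNormalForm.JanusBands
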